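import Literature.Topology.FourManifolds.HCobordismTheorem
import Literature.Topology.FourManifolds.HCobordismLowHandles
import Literature.Topology.FourManifolds.GradientLike
import HarnessLib

/-!
# The smooth h-cobordism theorem: assembly from the open leaves of Milnor's proof

Topic `Literature/Topology/FourManifolds` (fact seat
`provefact-Literature.SPC4.isTrivial_of_isHCobordism_of_five_le`).  This file only assembles; it
combines the proved reductions of the sibling files

* `HCobordismTheorem.lean` — Milnor's proof of Thm. 9.1 from the rungs F81 (Thm. 8.1 at both
  ends), F78 (Thm. 7.8) and Thm. 3.4 (`Literature.Topology.FourManifolds.isTrivial_of_isHCobordism_of_five_le_of_milnor1965`);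
* `HCobordismLowHandles.lean` — F81 from Thm. 2.5 and Thm. 8.1 at one end, by turning the triad
  about (`Literature.Topology.FourManifolds.Milnor1965_exists_isMorseFunction_two_le_index_of_left`);
* `GradientLike.lean` — Thm. 3.4 from the integration of the normalised gradient-like field
  (`Literature.Topology.FourManifolds.Cobordism.isTrivial_of_isMorseFunction_of_milnor1965`),

into the statement that the target fact `Literature.Topology.FourManifolds.isTrivial_of_isHCobordism_of_five_le` (the
smooth h-cobordism theorem, Milnor 1965, Thm. 9.1) — and with it Thm. 9.2
(`Literature.Topology.FourManifolds.nonempty_diffeomorph_of_isHCobordant_of_five_le`) — follows from the four leaves of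
the DAG that remain named facts:

1. `Literature.Topology.FourManifolds.Cobordism.exists_isMorseFunction` — Thm. 2.5, existence of a Morse function on a triad
   (`Handles.lean`);
2. `Literature.Topology.FourManifolds.Cobordism.Milnor1965_exists_isMorseFunction_two_le_index_left` — Thm. 8.1 at one end
   (`HCobordismLowHandles.lean`);
3. `Literature.Topology.FourManifolds.Milnor1965_exists_isMorseFunction_forall_not_isMCriticalPt` — Thm. 7.8
   (`HCobordismTheorem.lean`);
4. `Literature.Topology.FourManifolds.Cobordism.Milnor1965_exists_diffeomorph_of_mlineDeriv_eq_one` — the integration step of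
   the proof of Thm. 3.4 (`GradientLike.lean`);

(and, for Thm. 9.2, the tree's fact `Literature.Topology.FourManifolds.Cobordism.nonempty_diffeomorph_of_isTrivial`).

## References

* J. Milnor, *Lectures on the h-cobordism theorem*, Princeton Mathematical Notes (1965),
  Thms. 2.5, 3.4, 7.8, 8.1, 9.1, 9.2 (PDF pp. 12, 53–58 of the held copy
  `book:milnornd-lectures-h-cobordism-theorem`). [MilnorHCobordism1965]
-/

open scoped Manifold ContDiff Topology
open Set Function

noncomputable section

namespace Literature.Topology.FourManifolds

universe u

/-- **F81 from its leaves.**  The rung `Literature.Topology.FourManifolds.Milnor1965_exists_isMorseFunction_two_le_index`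
(a simply connected h-cobordism of dimension `≥ 5` carries a Morse function with all indices
in `[2, (n + 1) - 2]`) follows from Thm. 2.5 (`Literature.Topology.FourManifolds.Cobordism.exists_isMorseFunction`) and
Thm. 8.1 at one end (`Literature.Topology.FourManifolds.Cobordism.Milnor1965_exists_isMorseFunction_two_le_index_left`):
this is `Literature.Topology.FourManifolds.Milnor1965_exists_isMorseFunction_two_le_index_of_left`, whose conclusion is the
rung verbatim. [cite: MilnorHCobordism1965, proof of Thm. 9.1 (PDF p. 57), with Thm. 2.5 and Thm. 8.1] -/
theorem Milnor1965_exists_isMorseFunction_two_le_index_of_leaves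
    (h25 : ∀ {n : ℕ} {M N : Type u} [TopologicalSpace M]
      [ChartedSpace (EuclideanSpace ℝ (Fin n)) M] [TopologicalSpace N]
      [ChartedSpace (EuclideanSpace ℝ (Fin n)) N],
      Cobordism.exists_isMorseFunction (n := n) (M := M) (N := N))
    (h81 : Cobordism.Milnor1965_exists_isMorseFunction_two_le_index_left.{u}) :
    Milnor1965_exists_isMorseFunction_two_le_index.{u} := by
  intro n hn M N _ _ _ _ _ _ _ _ _ _ _ _ c hc hW
  exact Milnor1965_exists_isMorseFunction_two_le_index_of_left h25 h81 hn c hc hW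

section SPC4

/-- **The smooth h-cobordism theorem from the four open leaves of Milnor's proof.**  The target
fact `Literature.Topology.FourManifolds.isTrivial_of_isHCobordism_of_five_le` (Milnor 1965, Thm. 9.1: a simply connected
smooth h-cobordism between closed smooth `n`-manifolds, `n ≥ 5`, is a product rel `M`) follows
from: Thm. 2.5 (`Literature.Topology.FourManifolds.Cobordism.exists_isMorseFunction`), Thm. 8.1 at one end
(`Literature.Topology.FourManifolds.Cobordism.Milnor1965_exists_isMorseFunction_two_le_index_left`), Thm. 7.8
(`Literature.Topology.FourManifolds.Milnor1965_exists_isMorseFunction_forall_not_isMCriticalPt`) and the integration step of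
Thm. 3.4 (`Literature.Topology.FourManifolds.Cobordism.Milnor1965_exists_diffeomorph_of_mlineDeriv_eq_one`), via the proved
reductions `Milnor1965_exists_isMorseFunction_two_le_index_of_leaves`,
`Literature.Topology.FourManifolds.Cobordism.isTrivial_of_isMorseFunction_of_milnor1965` and
`isTrivial_of_isHCobordism_of_five_le_of_milnor1965` (the proof of Thm. 9.1 as printed).
[cite: MilnorHCobordism1965, Thm. 9.1 and its proof (PDF p. 57)] -/
theorem isTrivial_of_isHCobordism_of_five_le_of_leaves
    (h25 : ∀ {n : ℕ} {M N : Type u} [TopologicalSpace M]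
      [ChartedSpace (EuclideanSpace ℝ (Fin n)) M] [TopologicalSpace N]
      [ChartedSpace (EuclideanSpace ℝ (Fin n)) N],
      Cobordism.exists_isMorseFunction (n := n) (M := M) (N := N))
    (h81 : Cobordism.Milnor1965_exists_isMorseFunction_two_le_index_left.{u})
    (h78 : Milnor1965_exists_isMorseFunction_forall_not_isMCriticalPt.{u})
    (hflow : ∀ {n : ℕ} {M N : Type u} [TopologicalSpace M]
      [ChartedSpace (EuclideanSpace ℝ (Fin n)) M] [TopologicalSpace N]
      [ChartedSpace (EuclideanSpace ℝ (Fin n)) N],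
      Cobordism.Milnor1965_exists_diffeomorph_of_mlineDeriv_eq_one (n := n) (M := M) (N := N)) :
    isTrivial_of_isHCobordism_of_five_le.{u} := by
  refine isTrivial_of_isHCobordism_of_five_le_of_milnor1965
    (Milnor1965_exists_isMorseFunction_two_le_index_of_leaves h25 h81) h78 ?_
  intro n M N _ _ _ _
  exact Cobordism.isTrivial_of_isMorseFunction_of_milnor1965 hflow

/-- **Milnor 1965, Thm. 9.2 from the same leaves** (plus the tree's fact that a trivial
cobordism yields a diffeomorphism of its ends, `Literature.Topology.FourManifolds.Cobordism.nonempty_diffeomorph_of_isTrivial`):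
h-cobordant simply connected closed smooth manifolds of dimension `≥ 5` are diffeomorphic
(`Literature.Topology.FourManifolds.nonempty_diffeomorph_of_isHCobordant_of_five_le`). [cite: MilnorHCobordism1965, Thm. 9.2 (PDF pp. 57–58)] -/
theorem nonempty_diffeomorph_of_isHCobordant_of_five_le_of_leaves
    (h25 : ∀ {n : ℕ} {M N : Type u} [TopologicalSpace M]
      [ChartedSpace (EuclideanSpace ℝ (Fin n)) M] [TopologicalSpace N]
      [ChartedSpace (EuclideanSpace ℝ (Fin n)) N],
      Cobordism.exists_isMorseFunction (n := n) (M := M) (N := N))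
    (h81 : Cobordism.Milnor1965_exists_isMorseFunction_two_le_index_left.{u})
    (h78 : Milnor1965_exists_isMorseFunction_forall_not_isMCriticalPt.{u})
    (hflow : ∀ {n : ℕ} {M N : Type u} [TopologicalSpace M]
      [ChartedSpace (EuclideanSpace ℝ (Fin n)) M] [TopologicalSpace N]
      [ChartedSpace (EuclideanSpace ℝ (Fin n)) N],
      Cobordism.Milnor1965_exists_diffeomorph_of_mlineDeriv_eq_one (n := n) (M := M) (N := N))
    (hdiff : ∀ {n : ℕ} {M N : Type u} [TopologicalSpace M]
      [ChartedSpace (EuclideanSpace ℝ (Fin n)) M] [TopologicalSpace N]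
      [ChartedSpace (EuclideanSpace ℝ (Fin n)) N],
      Cobordism.nonempty_diffeomorph_of_isTrivial (n := n) (M := M) (N := N)) :
    nonempty_diffeomorph_of_isHCobordant_of_five_le.{u} :=
  nonempty_diffeomorph_of_isHCobordant_of_five_le_of_isTrivial
    (isTrivial_of_isHCobordism_of_five_le_of_leaves h25 h81 h78 hflow) hdiff

end SPC4

end Literature.Topology.FourManifolds
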